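import Summits.NavierStokesRegularity.NavierStokesRegularity.Theses.FilamentSkeletonRss
import Literature.Analysis.FluidPDE.GaussianVortexPlanarProofs
import Literature.Analysis.FluidPDE.GaussianVortexGroundState
import Literature.Analysis.FluidPDE.BurgersVortexSteady

/-!
# Disproof of `CoreLinearInvertibility` (stmt-NavierStokesRegularity-17973) — findings

Crux (route `FilamentSkeletonRss`, rank 4′): for every asymmetry `λ ∈ [0,1)` there are `R₀, c > 0`
such that for all `R ≥ R₀` the linearised planar core operator at the Gaussian,
`T_{λ,R} w = L_λ w − R Λ_G w`, `L_λ = Δ + (1+λ)/2·x₀∂₀ + (1−λ)/2·x₁∂₁ + 1`,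
`Λ_G w = v^G·∇w + (K_{2D}∗w)·∇G`, obeys `c² ∫ G_λ⁻¹ w² ≤ ∫ G_λ⁻¹ (T_{λ,R} w)²`
(`G_λ = (1−λ)/(4π) e^{−(1−λ)|x|²/4}`, Gallay–Maekawa (4.6)) for all `C²` `w` with `w, T w ∈ L²(G_λ⁻¹)`,
convergent Biot–Savart integrals, ZERO MASS and ZERO FIRST MOMENTS.

## Verdict of this cycle (cdisprove c1, 2026-08-17): NO KILL — the statement resists.  Sorry-free file.

FINDINGS (details in the sections below; prose only in docstrings):

1. ELABORATION / JUNK AUDIT (re-done independently; agrees with rattack-17973 and AUDIT-17973-c12):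
   rc 0; no junk reachable — `w ∈ C² ∩ L²(G_λ⁻¹)` forces `w, xᵢw ∈ L¹` (Cauchy–Schwarz against
   `∫ G_λ, ∫ xᵢ² G_λ < ∞`, needs `λ < 1`), so the three moment integrals are honest Bochner integrals;
   `biotSavart2D` junk is excluded by the pointwise integrability hypothesis (which is in fact REDUNDANT:
   it follows from `w ∈ C⁰ ∩ L¹`, cf. `integrable_smul_biotSavartKernel2D` — provers may derive it);
   `Δ`, `gradient`, `fderiv` of a `C²` map are genuine.  At `λ = 1` the weight `gaussWeightLam 1 = 0`
   makes BOTH sides `0` (`0⁻¹ = 0`): the statement extended to `λ ∈ [0,1]` is trivially true at the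
   endpoint — harmless, not exploitable.
2. STRUCTURE (why no cheap counterexample exists).  `T_{λ,R}` maps the constrained space
   `V = {∫w = ∫x₀w = ∫x₁w = 0}` into itself for every `λ, R`: `∫ L_λ w = 0` (divergence form
   `L_λ w = ∇·(∇w + Bx w)`, `B = diag((1+λ)/2,(1−λ)/2)`), `∫ Λ_G w = 0`, `∫ xᵢ L_λ w = −Bᵢᵢ ∫ xᵢ w`,
   `∫ xᵢ Λ_G w = −∫ (v^G_i w + (K∗w)_i G) = 0` (oddness of `K`).  So the flat adjoint has the exact,
   `R`-INDEPENDENT co-eigenvectors `1, x₀, x₁` (eigenvalues `0, −(1+λ)/2, −(1−λ)/2`) and the crux is the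
   statement that `T_{λ,R}|_V` has a bounded inverse with `R`-uniform bound.  After conjugation by
   `G_λ^{1/2}`, `L_λ` is a globally elliptic quadratic (Shubin) operator — symmetric part
   `Δ + ½ − κ(2−κ)|x|²/16 + λ(…)`, `κ = 1 − λ > 0` — with compact resolvent; `Λ_G` is `L_λ`-bounded with
   bound `0` (`v^G·∇` first order with bounded smooth coefficients, `(K∗·)·∇G` bounded).  Hence for EACH
   `(λ,R)` the bound holds with some `c(λ,R) > 0` iff `ker T_{λ,R} ∩ V = 0`, and `ker T_{λ,R}` on the full
   space is the line through `G + O(λ/R)` (mass `1`) whenever `T|_V` is invertible (`T G = λ M G ∈ V`).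
   The content is only UNIFORMITY as `R → ∞`, where the mechanism is favourable: `Λ_G` kills exactly the
   radial functions and `span{∂₀G, ∂₁G}` (tree: `GallayMaekawa2016_lem27_classical_holds`); the first
   moments remove `∂ᵢG`; on radial zero-mass `w`, `T w = L w ⊕ λ M w` (orthogonal angular sectors
   `n = 0` / `n = ±2`), so `‖T w‖ ≥ ‖L w‖_{X_λ} ≥ c_rad(λ) ‖w‖` with `c_rad(λ) > 0` INDEPENDENT of `R`;
   the non-radial sectors are attenuated by the fast rotation (`‖(L_λ − RΩ∂_θ)⁻¹‖ ≲ R^{-1/2}`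
   numerically).  A quasimode would have to sit at the "critical layer at infinity" (`Ω(r) → 0`), where the
   Ornstein–Uhlenbeck confinement `κ²r²/16` dominates `RΩ(r) ∼ R/r²` only beyond `r ∼ R^{1/4}`, and there
   both are `≳ R^{1/2}`: no small singular value can be manufactured this way.
3. LITERATURE: even angular sector = Maekawa, M3AS 19 (2009) §4 (4.9) in exactly this space/operator
   (right skew-symmetriser); `λ = 0` = Gallay–Wayne 2005 with `c = 1` for every `R`; odd sector in
   `L²(G_λ⁻¹)` unprinted but structurally easier (no radial block).  No printed counterexample; the
   barrier catalogue (`Literature/Barriers/NavierStokesRegularity/*`) does not touch a planar steady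
   linear statement; `ledger negatives` unrelated.  Physics literature (crossref, this session; searchd/OpenAlex
   degraded): Moffatt–Kida–Ohkitani, JFM 259 (1994) doi:10.1017/s002211209400011x (large-Re asymptotics of
   non-axisymmetric Burgers vortices for EVERY strain ratio — the expansion in `1/R` solves `T`-type linear
   problems order by order, axisymmetric at leading order), Prochazka–Pullin, JFM 363 (1998)
   doi:10.1017/s0022112098008866 (numerical steady states and linear stability for all `λ < 1`, large Re),
   Bajer–Moffatt 1998 doi:10.1007/978-94-011-5042-2_16: all consistent with uniform invertibility; no printed
   obstruction, quasimode or instability in the planar (`k = 0`) sector.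
4. NUMERICS (three earlier seats, three codes: rattack j024428 |n| ≤ 12, λ ≤ .75, R ≤ 3000; lead c12
   coarse + j024722/3; ideator-2 j025148/j025205): `σ_min(T|_V)` is bounded away from `0` and INCREASES
   with `R` for every tested `λ ≤ 0.95`; plateau = radial block `c_rad(λ) < 1` for `λ > 0`.  Not re-run
   here (a fourth code adds nothing a refutation could use).
5. LOAD-BEARING HYPOTHESES (§A; LANDED p164434 as `Theorems/CoreLinearInvertibility/Negative/
   MassZeroLoadBearing.lean`): the ZERO-MASS constraint is load-bearing — `T_{0,R} G = 0` for every `R`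
   (`coreOp_zero_gaussian`), so the crux minus `∫ w = 0` is false (`crux_false_without_massZero`).
   The FIRST-MOMENT constraints are NOT load-bearing for SOME `c > 0` (without them the slow directions
   `∂ᵢG`, `T_{0,R} ∂ᵢG = −½ ∂ᵢG`, only lower the constant: at `λ = 0` from `1` to `½`) — near-miss §C,
   not landed: it needs `K ∗ ∂ᵢG = ∂ᵢ v^G`, which the tree does not have.  `R₀` is NOT load-bearing at
   `λ = 0` (`c = 1` for all `R`); for `λ > 0` numerics show `σ_min` increasing from `R = 0`.  No
   uniformity in `λ ↑ 1` is claimed, and none should be expected (`c(λ) → 0`).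
6. TIGHTNESS (§B, PROVED here and LANDED p164732, commit a9b25fc8fadc, as `Negative/LamZeroTight.lean`): at `λ = 0` the constant
   `c = 1` is OPTIMAL — the radial zero-mass eigenfunction `w = ΔG = (|x|²/4 − 1)G ∈ V` meets every
   hypothesis and has `T_{0,R} w = −w` for every `R`, `∫ G⁻¹ w² = 1`; hence any admissible `c` at
   `λ = 0` has `c ≤ 1` (`crux_lamZero_const_le_one`).  This also certifies NON-VACUITY of the crux's
   hypothesis set by an explicit nonzero element of `V`.

7. LINE `Sketch` (PICKED.md, lead 0; skeleton `Lines/Sketch.lean`, stubs 1–4 landed, open: `stub_coreBoundEven`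
   (in print), `stub_oddSymmetrizerBounds` (6a), `stub_oddSymmetrizerBoundedBelow` (6b),
   `stub_oddAttenuation` (6c)).  Cheap attacks on the OPEN stubs, all PASS (no `-- Targets` kill; §E):
   * 6a exact identity checked by hand: `Λ_G = Ω∂_θ ∘ (I + K)`, `K w = Φ·(N∗w)`, because
     `(K∗w)·∇G = (G/2)∂_θ(N∗w)` and `ΩΦ = G/2`; `u = Φψ` is Gaussian class with rate `e^{−|x|²/4}` (`Φ ∼ (r²/4)e^{−r²/4}`,
     `ψ = N∗w = O(1/|x|)` for odd `w`), `Φ(|x|) = e^{−s}/φ(s)`, `s = |x|²/4`, is smooth at `0`; `‖L_λ u‖ ≲ ‖w‖` needs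
     `‖∇Φ·(K∗w)‖_{X_λ}` — fine by HLS (`K∗w ∈ L^s`, `s > 2`, from `w ∈ L¹ ∩ L²`), not by a pointwise bound.
   * 6b: `ker(I + K) ∩ odd = span{∂₁G, ∂₂G}` verified ((I+K)∂₁G = 0 since `N∗∂₁G = Ω x₁`, `ΦΩx₁ = x₁G/2 = −∂₁G`;
     conversely `ker(I+K) ⊆ ker Λ_G`); the first moments pair non-degenerately (`∫ x₁∂₁G = −1`); `K` is
     Hilbert–Schmidt on `X_λ` (`Φ²G_λ⁻¹ ∼ r⁴e^{−(1+λ)r²/4} ∈ L¹`, `log² ∈ L¹_loc`, `G_λ ∈ L¹`) ⇒ Fredholm ⇒ bounded below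
     on the closed constrained odd subspace.  Plausible-true.
   * 6c (attenuation of the LOCAL operator `H = L_λ − RΩ∂_θ` on odd Gaussian-class `v`): TRUE qualitatively by a
     compactness–uniqueness argument recorded in §E (`⟨Ω∂_θ v, v⟩_{X_λ} = 0` for real `v`; the symmetric part of the
     `G_λ^{1/2}`-conjugate of `−L_λ` is `≥ −Δ − ½ + (1−λ)²|x|²/16`, CONFINING for every `λ < 1`; a bounded sequence
     `‖H_R v_R‖ ≤ K`, `‖v_R‖ = 1` is precompact and its limit is annihilated by `∂_θ`, hence radial, hence even, hence
     `0`).  The two-component cancellation ansatz (`L_λ v_C = RΩ∂_θ v_S`, `L_λ v_S = RΩ∂_θ v_C`) forces `(L_λ − RΩ∂_θ)(v_C+v_S) = 0`,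
     impossible; no quasimode.  So the stub is a THEOREM-in-waiting, the quantitative rate (`R^{1/2}`) is not needed.
   * `stub_coreBoundEven`: Maekawa 2009 Lemma 4.1 (even = `x ↦ −x` invariance = even angular modes; mass zero built in).

WHY IT RESISTS, in one line: the only `R`-independent obstruction directions of `L_λ − RΛ_G` are
`ker Λ_G = radial ⊕ span{∂G}`, and the crux's three constraints are exactly the co-eigenvectors that
remove the non-decaying part of that kernel (`G`: mass; `∂ᵢG`: first moments), leaving the coercive radial
block of `L` and rotation-damped non-radial sectors.
-/

set_option linter.dupNamespace false

namespace Summit.NavierStokesRegularity.NavierStokesRegularity.Cruxes.CoreLinearInvertibility.Disproof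

open Summit.NavierStokesRegularity.NavierStokesRegularity.Theses.FilamentSkeletonRss
open Literature.Analysis.FluidPDE MeasureTheory Set
open scoped InnerProductSpace RealInnerProductSpace ContDiff

/-- The linearised planar core operator at the Gaussian, `T_{λ,R} w = L_λ w − R Λ_G w`, exactly the
expression appearing (twice) in the crux. -/
noncomputable def coreOp (lam R : ℝ) (w : EuclideanSpace ℝ (Fin 2) → ℝ)
    (x : EuclideanSpace ℝ (Fin 2)) : ℝ :=
  strainedVorticityOperator lam w x -
    R * (⟪gaussVortexVelocity x, gradient w x⟫ + ⟪biotSavart2D w x, gradient gaussVortexProfile x⟫)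

/-- The crux, restated through `coreOp` (definitionally the route decl; see `iff_crux`). -/
def Crux : Prop :=
  ∀ lam ∈ Set.Ico (0 : ℝ) 1, ∃ R₀ c : ℝ, 0 < c ∧ ∀ R : ℝ, R₀ ≤ R →
    ∀ w : EuclideanSpace ℝ (Fin 2) → ℝ, ContDiff ℝ 2 w →
    Integrable (fun x => (gaussWeightLam lam x)⁻¹ * w x ^ 2) →
    (∀ x, Integrable (fun y => w y • biotSavartKernel2D (x - y))) →
    Integrable (fun x => (gaussWeightLam lam x)⁻¹ * (coreOp lam R w x) ^ 2) →
    ∫ x, w x = 0 → ∫ x, x 0 * w x = 0 → ∫ x, x 1 * w x = 0 →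
    c ^ 2 * ∫ x, (gaussWeightLam lam x)⁻¹ * w x ^ 2 ≤
      ∫ x, (gaussWeightLam lam x)⁻¹ * (coreOp lam R w x) ^ 2

/-- The restatement IS the route decl. -/
theorem iff_crux : Crux ↔ CoreLinearInvertibility := Iff.rfl

/-! ## §A  Load-bearing analysis: the zero-mass constraint -/

/-- The crux with the zero-mass hypothesis `∫ w = 0` DELETED (everything else verbatim). -/
def CoreLinearInvertibilityWithoutMassZero : Prop :=
  ∀ lam ∈ Set.Ico (0 : ℝ) 1, ∃ R₀ c : ℝ, 0 < c ∧ ∀ R : ℝ, R₀ ≤ R →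
    ∀ w : EuclideanSpace ℝ (Fin 2) → ℝ, ContDiff ℝ 2 w →
    Integrable (fun x => (gaussWeightLam lam x)⁻¹ * w x ^ 2) →
    (∀ x, Integrable (fun y => w y • biotSavartKernel2D (x - y))) →
    Integrable (fun x => (gaussWeightLam lam x)⁻¹ * (coreOp lam R w x) ^ 2) →
    ∫ x, x 0 * w x = 0 → ∫ x, x 1 * w x = 0 →
    c ^ 2 * ∫ x, (gaussWeightLam lam x)⁻¹ * w x ^ 2 ≤
      ∫ x, (gaussWeightLam lam x)⁻¹ * (coreOp lam R w x) ^ 2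

/-- The deleted-hypothesis statement is stronger than the crux (sanity of the definition). -/
theorem crux_of_withoutMassZero (h : CoreLinearInvertibilityWithoutMassZero) : Crux := by
  intro lam hlam
  obtain ⟨R₀, c, hc, H⟩ := h lam hlam
  exact ⟨R₀, c, hc, fun R hR w h1 h2 h3 h4 _ h6 h7 => H R hR w h1 h2 h3 h4 h6 h7⟩

/-- `v^G · ∇G = 0`. [folklore] -/
theorem inner_gaussVortexVelocity_gradient_gaussian (x : EuclideanSpace ℝ (Fin 2)) :
    ⟪gaussVortexVelocity x, gradient gaussVortexProfile x⟫ = 0 := by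
  rw [real_inner_comm, gradient, InnerProductSpace.toDual_symm_apply,
    fderiv_gaussVortexProfile_apply, gaussVortexVelocity, inner_smul_right, inner_self_perp]
  ring

/-- `(K ∗ G) · ∇G = 0`. [folklore] -/
theorem inner_biotSavart2D_gaussian_gradient_gaussian (x : EuclideanSpace ℝ (Fin 2)) :
    ⟪biotSavart2D gaussVortexProfile x, gradient gaussVortexProfile x⟫ = 0 := by
  have h1 : (fun y : EuclideanSpace ℝ (Fin 2) => (1 : ℝ) * gaussVortexProfile y) =
      gaussVortexProfile := by
    funext y; exact one_mul _
  have := inner_biotSavart2D_gradient_gaussian 1 x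
  rwa [h1] at this

/-- **`T_{0,R} G = 0` for every `R`** — the `R`-independent kernel direction at `λ = 0`. [folklore] -/
theorem coreOp_zero_gaussian (R : ℝ) (x : EuclideanSpace ℝ (Fin 2)) :
    coreOp 0 R gaussVortexProfile x = 0 := by
  have h1 : (fun y : EuclideanSpace ℝ (Fin 2) => (1 : ℝ) * gaussVortexProfile y) =
      gaussVortexProfile := by
    funext y; exact one_mul _
  have hL := strainedVorticityOperator_zero_gaussian 1 x
  rw [h1] at hL
  rw [coreOp, hL, inner_gaussVortexVelocity_gradient_gaussian,
    inner_biotSavart2D_gaussian_gradient_gaussian]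
  ring

/-- First moments of `G` vanish (evenness, via the isometry `x ↦ −x`). [folklore] -/
theorem integral_coord_mul_gaussian (i : Fin 2) :
    ∫ x : EuclideanSpace ℝ (Fin 2), x i * gaussVortexProfile x = 0 := by
  set S : EuclideanSpace ℝ (Fin 2) ≃ₗᵢ[ℝ] EuclideanSpace ℝ (Fin 2) := LinearIsometryEquiv.neg ℝ with hS
  have hodd : ∀ x : EuclideanSpace ℝ (Fin 2),
      (S x) i * gaussVortexProfile (S x) = -(x i * gaussVortexProfile x) := by
    intro x
    have hn : gaussVortexProfile (S x) = gaussVortexProfile x := by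
      simp [hS, gaussVortexProfile, norm_neg]
    rw [hn]; simp [hS]
  have hI : ∫ x : EuclideanSpace ℝ (Fin 2), (S x) i * gaussVortexProfile (S x) =
      ∫ x : EuclideanSpace ℝ (Fin 2), x i * gaussVortexProfile x :=
    MeasureTheory.integral_comp S (fun x : EuclideanSpace ℝ (Fin 2) => x i * gaussVortexProfile x)
  simp_rw [hodd, integral_neg] at hI
  linarith

/-- **(A1) The zero-mass constraint is load-bearing**: witness `λ = 0`, `w = G`, any `R ≥ R₀`
(`T_{0,R}G = 0`, `∫ G⁻¹G² = ∫ G = 1`, first moments `0`).  LANDED (p164434) verbatim (inline statement) as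
`Theorems/CoreLinearInvertibility/Negative/MassZeroLoadBearing.lean ::
coreLinearInvertibility_false_without_massZero`. [folklore] -/
theorem crux_false_without_massZero : ¬ CoreLinearInvertibilityWithoutMassZero := by
  intro h
  obtain ⟨R₀, c, hc, hR⟩ := h 0 ⟨le_rfl, one_pos⟩
  have hG1 : ∀ x : EuclideanSpace ℝ (Fin 2),
      (gaussVortexProfile x)⁻¹ * gaussVortexProfile x ^ 2 = gaussVortexProfile x :=
    fun x => by have := (gaussVortexProfile_pos x).ne'; field_simp
  have hBS : ∀ x : EuclideanSpace ℝ (Fin 2),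
      Integrable (fun y => gaussVortexProfile y • biotSavartKernel2D (x - y)) := by
    intro x
    have := integrable_gaussian_smul_biotSavartKernel2D 1 x
    simpa only [one_mul] using this
  have key := hR R₀ le_rfl gaussVortexProfile contDiff_gaussVortexProfile ?_ hBS ?_
    (integral_coord_mul_gaussian 0) (integral_coord_mul_gaussian 1)
  · simp_rw [coreOp_zero_gaussian, gaussWeightLam_zero, hG1, integral_gaussVortexProfile] at key
    norm_num at key
    nlinarith [sq_pos_of_pos hc]
  · simp_rw [gaussWeightLam_zero, hG1]; exact integrable_gaussVortexProfile
  · simp_rw [coreOp_zero_gaussian, gaussWeightLam_zero]; simp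

/-! ## §B  Tightness at `λ = 0`: `c = 1` cannot be improved (witness `ΔG`); non-vacuity of `V`

(Identical content LANDED as `Theorems/CoreLinearInvertibility/Negative/LamZeroTight.lean`, p164732; it is
duplicated here so that this work file stays self-contained — a later cycle may import that module instead.) -/

/-! ### The quadratic factor `q(x) = |x|²/4 − 1` -/

/-- `q` is smooth. [folklore] -/
theorem contDiff_quad {n : WithTop ℕ∞} : ContDiff ℝ n (fun y : (EuclideanSpace ℝ (Fin 2)) => (4 : ℝ)⁻¹ * ‖y‖ ^ 2 - 1) :=
  (contDiff_const.mul (contDiff_norm_sq ℝ)).sub contDiff_const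

/-- `Dq(x) = ½⟪x, ·⟫`. [folklore] -/
theorem hasFDerivAt_quad (x : (EuclideanSpace ℝ (Fin 2))) :
    HasFDerivAt (fun y : (EuclideanSpace ℝ (Fin 2)) => (4 : ℝ)⁻¹ * ‖y‖ ^ 2 - 1) ((4 : ℝ)⁻¹ • (2 • innerSL ℝ x)) x :=
  ((hasStrictFDerivAt_norm_sq x).hasFDerivAt.const_mul (4 : ℝ)⁻¹).sub_const 1

/-- `Dq(x)[v] = ½⟪x, v⟫`. [folklore] -/
theorem fderiv_quad_apply (x v : (EuclideanSpace ℝ (Fin 2))) :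
    fderiv ℝ (fun y : (EuclideanSpace ℝ (Fin 2)) => (4 : ℝ)⁻¹ * ‖y‖ ^ 2 - 1) x v = 2⁻¹ * ⟪x, v⟫ := by
  rw [(hasFDerivAt_quad x).fderiv]
  simp
  ring

/-- `∂ᵢ q(y) = ½ yᵢ` as functions. [folklore] -/
theorem fderiv_quad_single (i : Fin 2) :
    (fun y : (EuclideanSpace ℝ (Fin 2)) => fderiv ℝ (fun z : (EuclideanSpace ℝ (Fin 2)) => (4 : ℝ)⁻¹ * ‖z‖ ^ 2 - 1) y
      (EuclideanSpace.single i (1 : ℝ))) = fun y => 2⁻¹ * y i := by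
  funext y
  rw [fderiv_quad_apply, inner_single_one_right]

/-- `Δq = 1` on `ℝ²`. [folklore] -/
theorem laplacian_quad (x : (EuclideanSpace ℝ (Fin 2))) :
    Laplacian.laplacian (fun y : (EuclideanSpace ℝ (Fin 2)) => ((4 : ℝ)⁻¹ * ‖y‖ ^ 2 - 1 : ℝ)) x = 1 := by
  rw [laplacian_eq_fin_two contDiff_quad, fderiv_quad_single 0, fderiv_quad_single 1]
  have h : ∀ i : Fin 2, fderiv ℝ (fun y : (EuclideanSpace ℝ (Fin 2)) => 2⁻¹ * y i) x (EuclideanSpace.single i (1 : ℝ)) =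
      2⁻¹ := by
    intro i
    have hd : HasFDerivAt (fun y : (EuclideanSpace ℝ (Fin 2)) => 2⁻¹ * y i)
        ((2⁻¹ : ℝ) • (EuclideanSpace.proj i : (EuclideanSpace ℝ (Fin 2)) →L[ℝ] ℝ)) x :=
      (EuclideanSpace.proj i : (EuclideanSpace ℝ (Fin 2)) →L[ℝ] ℝ).hasFDerivAt.const_mul 2⁻¹
    rw [hd.fderiv]
    simp
  rw [h 0, h 1]
  norm_num

/-! ### The witness `w = G q = ΔG` and the operator identity `T_{0,R} w = −w` -/

/-- **`L (Gq) = −Gq`** (`L = Δ + ½x·∇ + 1`): `Gq = ΔG` is the radial eigenfunction of `L` with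
eigenvalue `−1` (ground-state conjugation `L(Gh) = G(Δh − ½x·∇h)`, `Δq = 1`, `½x·∇q = |x|²/4`). [folklore] -/
theorem strainedVorticityOperator_zero_witness (x : (EuclideanSpace ℝ (Fin 2))) :
    strainedVorticityOperator 0 (fun y : (EuclideanSpace ℝ (Fin 2)) => gaussVortexProfile y * ((4 : ℝ)⁻¹ * ‖y‖ ^ 2 - 1)) x =
      -(gaussVortexProfile x * ((4 : ℝ)⁻¹ * ‖x‖ ^ 2 - 1)) := by
  have hL := strainedVorticityOperator_zero_gaussian_mul
    (h := fun y : (EuclideanSpace ℝ (Fin 2)) => (4 : ℝ)⁻¹ * ‖y‖ ^ 2 - 1) contDiff_quad x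
  rw [hL, laplacian_quad, fderiv_quad_apply, real_inner_self_eq_norm_sq]
  ring

/-- `D(Gq)(x)[v] = (G(x)/2)(1 − q(x)) ⟪x, v⟫` — in particular radial. [folklore] -/
theorem fderiv_witness_apply (x v : (EuclideanSpace ℝ (Fin 2))) :
    fderiv ℝ (fun y : (EuclideanSpace ℝ (Fin 2)) => gaussVortexProfile y * ((4 : ℝ)⁻¹ * ‖y‖ ^ 2 - 1)) x v =
      gaussVortexProfile x / 2 * (1 - ((4 : ℝ)⁻¹ * ‖x‖ ^ 2 - 1)) * ⟪x, v⟫ := by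
  have hG : HasFDerivAt gaussVortexProfile (fderiv ℝ gaussVortexProfile x) x :=
    (differentiable_gaussVortexProfile x).hasFDerivAt
  rw [(hG.fun_mul (hasFDerivAt_quad x)).fderiv]
  simp [fderiv_gaussVortexProfile_apply]
  ring

/-- `v^G · ∇(Gq) = 0`. [folklore] -/
theorem inner_gaussVortexVelocity_gradient_witness (x : (EuclideanSpace ℝ (Fin 2))) :
    ⟪gaussVortexVelocity x,
      gradient (fun y : (EuclideanSpace ℝ (Fin 2)) => gaussVortexProfile y * ((4 : ℝ)⁻¹ * ‖y‖ ^ 2 - 1)) x⟫ = 0 := by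
  rw [real_inner_comm, gradient, InnerProductSpace.toDual_symm_apply, fderiv_witness_apply,
    gaussVortexVelocity, inner_smul_right, inner_self_perp]
  ring

/-- The witness is radial. [folklore] -/
theorem witness_radial (y z : (EuclideanSpace ℝ (Fin 2))) (h : ‖y‖ = ‖z‖) :
    gaussVortexProfile y * ((4 : ℝ)⁻¹ * ‖y‖ ^ 2 - 1) =
      gaussVortexProfile z * ((4 : ℝ)⁻¹ * ‖z‖ ^ 2 - 1) := by
  simp only [gaussVortexProfile, h]

/-- `(K ∗ (Gq)) · ∇G = 0` wherever the Biot–Savart integral converges (radial density ⇒ azimuthal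
velocity). [folklore] -/
theorem inner_biotSavart2D_witness_gradient_gaussian (x : (EuclideanSpace ℝ (Fin 2)))
    (hint : Integrable (fun y => (gaussVortexProfile y * ((4 : ℝ)⁻¹ * ‖y‖ ^ 2 - 1)) •
      biotSavartKernel2D (x - y))) :
    ⟪biotSavart2D (fun y : (EuclideanSpace ℝ (Fin 2)) => gaussVortexProfile y * ((4 : ℝ)⁻¹ * ‖y‖ ^ 2 - 1)) x,
      gradient gaussVortexProfile x⟫ = 0 := by
  rw [real_inner_comm, gradient, InnerProductSpace.toDual_symm_apply,
    fderiv_gaussVortexProfile_apply, inner_biotSavart2D_eq_zero_of_radial witness_radial x hint]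
  ring

/-! ### Gaussian domination and integrability of the witness -/

/-- `G(x/2) = (4π)⁻¹ e^{−|x|²/16}`. [folklore] -/
theorem gaussVortexProfile_half_smul (x : (EuclideanSpace ℝ (Fin 2))) :
    gaussVortexProfile ((2 : ℝ)⁻¹ • x) = (4 * Real.pi)⁻¹ * Real.exp (-(‖x‖ ^ 2 / 16)) := by
  have h : ‖(2 : ℝ)⁻¹ • x‖ ^ 2 / 4 = ‖x‖ ^ 2 / 16 := by
    rw [norm_smul, Real.norm_eq_abs, abs_of_pos (by norm_num : (0 : ℝ) < 2⁻¹)]; ring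
  rw [gaussVortexProfile, h]

/-- `|q(x)| ≤ 2 e^{3|x|²/16}`. [folklore] -/
theorem abs_quad_le (x : (EuclideanSpace ℝ (Fin 2))) :
    |(4 : ℝ)⁻¹ * ‖x‖ ^ 2 - 1| ≤ 2 * Real.exp (3 * ‖x‖ ^ 2 / 16) := by
  have hs : 0 ≤ ‖x‖ ^ 2 := by positivity
  have he := Real.add_one_le_exp (3 * ‖x‖ ^ 2 / 16)
  rw [abs_le]
  constructor <;> nlinarith

/-- `q(x)² ≤ 17 e^{3|x|²/16}`. [folklore] -/
theorem quad_sq_le (x : (EuclideanSpace ℝ (Fin 2))) :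
    ((4 : ℝ)⁻¹ * ‖x‖ ^ 2 - 1) ^ 2 ≤ 17 * Real.exp (3 * ‖x‖ ^ 2 / 16) := by
  have hs : 0 ≤ ‖x‖ ^ 2 := by positivity
  have he := Real.quadratic_le_exp_of_nonneg (show 0 ≤ 3 * ‖x‖ ^ 2 / 16 by positivity)
  nlinarith

/-- `e^{−|x|²/4} e^{3|x|²/16} = e^{−|x|²/16}`. [folklore] -/
theorem exp_quarter_mul_exp (x : (EuclideanSpace ℝ (Fin 2))) :
    Real.exp (-(‖x‖ ^ 2 / 4)) * Real.exp (3 * ‖x‖ ^ 2 / 16) = Real.exp (-(‖x‖ ^ 2 / 16)) := by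
  rw [← Real.exp_add]
  congr 1
  ring

/-- `|G q| ≤ 2 G(·/2)`: the witness is dominated by a wider Gaussian. [folklore] -/
theorem abs_witness_le (x : (EuclideanSpace ℝ (Fin 2))) :
    |gaussVortexProfile x * ((4 : ℝ)⁻¹ * ‖x‖ ^ 2 - 1)| ≤ 2 * gaussVortexProfile ((2 : ℝ)⁻¹ • x) := by
  rw [abs_mul, abs_of_pos (gaussVortexProfile_pos x), gaussVortexProfile_half_smul,
    gaussVortexProfile]
  have hπ : 0 ≤ (4 * Real.pi)⁻¹ * Real.exp (-(‖x‖ ^ 2 / 4)) := by positivity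
  calc (4 * Real.pi)⁻¹ * Real.exp (-(‖x‖ ^ 2 / 4)) * |(4 : ℝ)⁻¹ * ‖x‖ ^ 2 - 1|
      ≤ (4 * Real.pi)⁻¹ * Real.exp (-(‖x‖ ^ 2 / 4)) * (2 * Real.exp (3 * ‖x‖ ^ 2 / 16)) :=
        mul_le_mul_of_nonneg_left (abs_quad_le x) hπ
    _ = 2 * ((4 * Real.pi)⁻¹ * Real.exp (-(‖x‖ ^ 2 / 16))) := by rw [← exp_quarter_mul_exp]; ring

/-- `G q² ≤ 17 G(·/2)`: the weighted square of the witness is dominated by a wider Gaussian. [folklore] -/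
theorem witness_sq_weight_le (x : (EuclideanSpace ℝ (Fin 2))) :
    gaussVortexProfile x * ((4 : ℝ)⁻¹ * ‖x‖ ^ 2 - 1) ^ 2 ≤ 17 * gaussVortexProfile ((2 : ℝ)⁻¹ • x) := by
  rw [gaussVortexProfile_half_smul, gaussVortexProfile]
  have hπ : 0 ≤ (4 * Real.pi)⁻¹ * Real.exp (-(‖x‖ ^ 2 / 4)) := by positivity
  calc (4 * Real.pi)⁻¹ * Real.exp (-(‖x‖ ^ 2 / 4)) * ((4 : ℝ)⁻¹ * ‖x‖ ^ 2 - 1) ^ 2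
      ≤ (4 * Real.pi)⁻¹ * Real.exp (-(‖x‖ ^ 2 / 4)) * (17 * Real.exp (3 * ‖x‖ ^ 2 / 16)) :=
        mul_le_mul_of_nonneg_left (quad_sq_le x) hπ
    _ = 17 * ((4 * Real.pi)⁻¹ * Real.exp (-(‖x‖ ^ 2 / 16))) := by rw [← exp_quarter_mul_exp]; ring

/-- The witness is continuous. [folklore] -/
theorem continuous_witness :
    Continuous (fun y : (EuclideanSpace ℝ (Fin 2)) => gaussVortexProfile y * ((4 : ℝ)⁻¹ * ‖y‖ ^ 2 - 1)) :=
  (contDiff_gaussVortexProfile (n := 0)).continuous.mul (contDiff_quad (n := 0)).continuous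

/-- The wider Gaussian `G(·/2)` is integrable. [folklore] -/
theorem integrable_gaussVortexProfile_half_smul :
    Integrable (fun x : (EuclideanSpace ℝ (Fin 2)) => gaussVortexProfile ((2 : ℝ)⁻¹ • x)) :=
  integrable_gaussVortexProfile.comp_smul (by norm_num)

/-- The witness `G q` is integrable. [folklore] -/
theorem integrable_witness :
    Integrable (fun y : (EuclideanSpace ℝ (Fin 2)) => gaussVortexProfile y * ((4 : ℝ)⁻¹ * ‖y‖ ^ 2 - 1)) := by
  refine Integrable.mono' (integrable_gaussVortexProfile_half_smul.const_mul 2)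
    continuous_witness.aestronglyMeasurable (Filter.Eventually.of_forall fun x => ?_)
  rw [Real.norm_eq_abs]
  exact abs_witness_le x

/-- `G q²` (the `L²(G⁻¹)` density of the witness) is integrable. [folklore] -/
theorem integrable_witness_sq_weight :
    Integrable (fun y : (EuclideanSpace ℝ (Fin 2)) => gaussVortexProfile y * ((4 : ℝ)⁻¹ * ‖y‖ ^ 2 - 1) ^ 2) := by
  have hc : Continuous (fun y : (EuclideanSpace ℝ (Fin 2)) => gaussVortexProfile y * ((4 : ℝ)⁻¹ * ‖y‖ ^ 2 - 1) ^ 2) :=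
    (contDiff_gaussVortexProfile (n := 0)).continuous.mul ((contDiff_quad (n := 0)).continuous.pow 2)
  refine Integrable.mono' (integrable_gaussVortexProfile_half_smul.const_mul 17)
    hc.aestronglyMeasurable (Filter.Eventually.of_forall fun x => ?_)
  rw [Real.norm_of_nonneg (mul_nonneg (gaussVortexProfile_pos x).le (sq_nonneg _))]
  exact witness_sq_weight_le x

/-- The Biot–Savart integral of the witness converges absolutely at every point. [folklore] -/
theorem integrable_witness_smul_biotSavartKernel2D (x : (EuclideanSpace ℝ (Fin 2))) :
    Integrable (fun y => (gaussVortexProfile y * ((4 : ℝ)⁻¹ * ‖y‖ ^ 2 - 1)) •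
      biotSavartKernel2D (x - y)) := by
  refine integrable_smul_biotSavartKernel2D integrable_witness (M := 2 * (4 * Real.pi)⁻¹)
    (fun y => (abs_witness_le y).trans ?_) x
  exact mul_le_mul_of_nonneg_left (gaussVortexProfile_le _) two_pos.le

/-! ### The three moment integrals and the weighted norm of the witness -/

/-- `∫₀^∞ e^{−t} t dt = Γ(2) = 1`. [folklore] -/
theorem integral_exp_neg_mul_self : ∫ t in Ioi (0 : ℝ), Real.exp (-t) * t = 1 := by
  have h := Real.Gamma_eq_integral (by norm_num : (0 : ℝ) < 2)
  rw [show (2 : ℝ) - 1 = 1 by norm_num] at h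
  simp_rw [Real.rpow_one] at h
  rw [← h]
  simp

/-- `∫₀^∞ e^{−t} t² dt = Γ(3) = 2`. [folklore] -/
theorem integral_exp_neg_mul_sq : ∫ t in Ioi (0 : ℝ), Real.exp (-t) * t ^ 2 = 2 := by
  have h := Real.Gamma_eq_integral (by norm_num : (0 : ℝ) < 3)
  rw [show (3 : ℝ) - 1 = 2 by norm_num] at h
  simp_rw [Real.rpow_two] at h
  rw [← h]
  simp

/-- Integrability of `e^{−t} t` on `(0, ∞)`. [folklore] -/
theorem integrableOn_exp_neg_mul_self : IntegrableOn (fun t : ℝ => Real.exp (-t) * t) (Ioi 0) := by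
  have h := Real.GammaIntegral_convergent (by norm_num : (0 : ℝ) < 2)
  rw [show (2 : ℝ) - 1 = 1 by norm_num] at h
  simp_rw [Real.rpow_one] at h
  exact h

/-- Integrability of `e^{−t} t²` on `(0, ∞)`. [folklore] -/
theorem integrableOn_exp_neg_mul_sq : IntegrableOn (fun t : ℝ => Real.exp (-t) * t ^ 2) (Ioi 0) := by
  have h := Real.GammaIntegral_convergent (by norm_num : (0 : ℝ) < 3)
  rw [show (3 : ℝ) - 1 = 2 by norm_num] at h
  simp_rw [Real.rpow_two] at h
  exact h

/-- `∫₀^∞ e^{−t}(t − 1) dt = 0`. [folklore] -/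
theorem integral_exp_neg_mul_sub_one : ∫ t in Ioi (0 : ℝ), Real.exp (-t) * (t - 1) = 0 := by
  have h : (fun t : ℝ => Real.exp (-t) * (t - 1)) = fun t => Real.exp (-t) * t - Real.exp (-t) := by
    funext t; ring
  rw [h, integral_sub integrableOn_exp_neg_mul_self (integrableOn_exp_neg_Ioi 0),
    integral_exp_neg_mul_self, integral_exp_neg_Ioi_zero, sub_self]

/-- `∫₀^∞ e^{−t}(t − 1)² dt = 1`. [folklore] -/
theorem integral_exp_neg_mul_sub_one_sq :
    ∫ t in Ioi (0 : ℝ), Real.exp (-t) * (t - 1) ^ 2 = 1 := by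
  have h : (fun t : ℝ => Real.exp (-t) * (t - 1) ^ 2) =
      fun t => Real.exp (-t) * t ^ 2 - 2 * (Real.exp (-t) * t) + Real.exp (-t) := by
    funext t; ring
  have h2 : IntegrableOn (fun t : ℝ => 2 * (Real.exp (-t) * t)) (Ioi 0) :=
    integrableOn_exp_neg_mul_self.const_mul 2
  have hAB : IntegrableOn (fun t : ℝ => Real.exp (-t) * t ^ 2 - 2 * (Real.exp (-t) * t)) (Ioi 0) :=
    integrableOn_exp_neg_mul_sq.sub h2
  rw [h, integral_add hAB (integrableOn_exp_neg_Ioi 0), integral_sub integrableOn_exp_neg_mul_sq h2,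
    integral_const_mul, integral_exp_neg_mul_sq, integral_exp_neg_mul_self, integral_exp_neg_Ioi_zero]
  norm_num

open Literature.Analysis.FluidPDE.StrainedAzimuthal in
/-- **Zero mass of the witness**: `∫ (|x|²/4 − 1) G = 0` (the planar second moment `∫ |x|² G = 4`),
by radial integration `∫_{ℝ²} F(|y|²/4) dy = 4π ∫₀^∞ F`. [folklore] -/
theorem integral_witness :
    ∫ y : (EuclideanSpace ℝ (Fin 2)), gaussVortexProfile y * ((4 : ℝ)⁻¹ * ‖y‖ ^ 2 - 1) = 0 := by
  have hF : (fun y : (EuclideanSpace ℝ (Fin 2)) => gaussVortexProfile y * ((4 : ℝ)⁻¹ * ‖y‖ ^ 2 - 1)) = fun y : (EuclideanSpace ℝ (Fin 2)) =>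
      (fun t : ℝ => (4 * Real.pi)⁻¹ * Real.exp (-t) * (t - 1)) ((4 : ℝ)⁻¹ * ‖y‖ ^ 2) := by
    funext y
    rw [gaussVortexProfile, div_eq_inv_mul]
  rw [hF, integral_comp_mul_norm_sq (fun t : ℝ => (4 * Real.pi)⁻¹ * Real.exp (-t) * (t - 1))
    (by norm_num : (0 : ℝ) < 4⁻¹)]
  simp_rw [mul_assoc]
  rw [integral_const_mul, integral_exp_neg_mul_sub_one]
  simp

open Literature.Analysis.FluidPDE.StrainedAzimuthal in
/-- **Unit weighted norm of the witness**: `∫ G⁻¹ (Gq)² = ∫ G q² = 1`. [folklore] -/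
theorem integral_witness_sq_weight :
    ∫ y : (EuclideanSpace ℝ (Fin 2)), gaussVortexProfile y * ((4 : ℝ)⁻¹ * ‖y‖ ^ 2 - 1) ^ 2 = 1 := by
  have hF : (fun y : (EuclideanSpace ℝ (Fin 2)) => gaussVortexProfile y * ((4 : ℝ)⁻¹ * ‖y‖ ^ 2 - 1) ^ 2) = fun y : (EuclideanSpace ℝ (Fin 2)) =>
      (fun t : ℝ => (4 * Real.pi)⁻¹ * Real.exp (-t) * (t - 1) ^ 2) ((4 : ℝ)⁻¹ * ‖y‖ ^ 2) := by
    funext y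
    rw [gaussVortexProfile, div_eq_inv_mul]
  rw [hF, integral_comp_mul_norm_sq (fun t : ℝ => (4 * Real.pi)⁻¹ * Real.exp (-t) * (t - 1) ^ 2)
    (by norm_num : (0 : ℝ) < 4⁻¹)]
  simp_rw [mul_assoc]
  rw [integral_const_mul, integral_exp_neg_mul_sub_one_sq]
  have hπ : Real.pi ≠ 0 := Real.pi_pos.ne'
  field_simp

/-- First moments of the (even) witness vanish. [folklore] -/
theorem integral_coord_mul_witness (i : Fin 2) :
    ∫ x : (EuclideanSpace ℝ (Fin 2)), x i * (gaussVortexProfile x * ((4 : ℝ)⁻¹ * ‖x‖ ^ 2 - 1)) = 0 := by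
  set S : (EuclideanSpace ℝ (Fin 2)) ≃ₗᵢ[ℝ] (EuclideanSpace ℝ (Fin 2)) := LinearIsometryEquiv.neg ℝ with hS
  have hodd : ∀ x : (EuclideanSpace ℝ (Fin 2)), (S x) i * (gaussVortexProfile (S x) * ((4 : ℝ)⁻¹ * ‖S x‖ ^ 2 - 1)) =
      -(x i * (gaussVortexProfile x * ((4 : ℝ)⁻¹ * ‖x‖ ^ 2 - 1))) := by
    intro x
    have hn : ‖S x‖ = ‖x‖ := S.norm_map x
    rw [witness_radial _ _ hn]
    simp [hS]
  have hI : ∫ x : (EuclideanSpace ℝ (Fin 2)), (S x) i * (gaussVortexProfile (S x) * ((4 : ℝ)⁻¹ * ‖S x‖ ^ 2 - 1)) =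
      ∫ x : (EuclideanSpace ℝ (Fin 2)), x i * (gaussVortexProfile x * ((4 : ℝ)⁻¹ * ‖x‖ ^ 2 - 1)) :=
    MeasureTheory.integral_comp S
      (fun x : (EuclideanSpace ℝ (Fin 2)) => x i * (gaussVortexProfile x * ((4 : ℝ)⁻¹ * ‖x‖ ^ 2 - 1)))
  simp_rw [hodd, integral_neg] at hI
  linarith

/-! ### The tightness theorem -/

/-- **`T_{0,R} (Gq) = −Gq` for every `R`**: the witness is an `R`-independent eigenfunction of the
linearised core operator at `λ = 0` with eigenvalue `−1` (`L(Gq) = −Gq`, and both Biot–Savart terms of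
`Λ_G` vanish on the radial function `Gq`). [folklore] -/
theorem coreOperator_witness_eq_neg (R : ℝ) (x : (EuclideanSpace ℝ (Fin 2))) :
    strainedVorticityOperator 0 (fun y : (EuclideanSpace ℝ (Fin 2)) => gaussVortexProfile y * ((4 : ℝ)⁻¹ * ‖y‖ ^ 2 - 1)) x -
        R * (⟪gaussVortexVelocity x,
              gradient (fun y : (EuclideanSpace ℝ (Fin 2)) => gaussVortexProfile y * ((4 : ℝ)⁻¹ * ‖y‖ ^ 2 - 1)) x⟫ +
          ⟪biotSavart2D (fun y : (EuclideanSpace ℝ (Fin 2)) => gaussVortexProfile y * ((4 : ℝ)⁻¹ * ‖y‖ ^ 2 - 1)) x,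
              gradient gaussVortexProfile x⟫) =
      -(gaussVortexProfile x * ((4 : ℝ)⁻¹ * ‖x‖ ^ 2 - 1)) := by
  rw [strainedVorticityOperator_zero_witness, inner_gaussVortexVelocity_gradient_witness,
    inner_biotSavart2D_witness_gradient_gaussian x (integrable_witness_smul_biotSavartKernel2D x)]
  ring

/-- `G⁻¹ (Gq)² = G q²` pointwise. [folklore] -/
theorem inv_gaussian_mul_witness_sq (x : (EuclideanSpace ℝ (Fin 2))) :
    (gaussVortexProfile x)⁻¹ * (gaussVortexProfile x * ((4 : ℝ)⁻¹ * ‖x‖ ^ 2 - 1)) ^ 2 =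
      gaussVortexProfile x * ((4 : ℝ)⁻¹ * ‖x‖ ^ 2 - 1) ^ 2 := by
  have h := (gaussVortexProfile_pos x).ne'
  field_simp

/-- **Tightness of `CoreLinearInvertibility` at `λ = 0`: no constant beyond `c = 1`.**  Whatever
`R₀` and `c > 0` realise the crux's a priori bound at asymmetry `λ = 0` (the body of
`CoreLinearInvertibility` at `lam = 0`, verbatim), necessarily `c ≤ 1`: the radial zero-mass test
vorticity `w = ΔG = (|x|²/4 − 1)G` satisfies every hypothesis (it is smooth, `∫ G⁻¹w² = 1`, its
Biot–Savart integrals converge, `∫ w = ∫ xᵢ w = 0`) and `T_{0,R} w = −w` for every `R`, so the bound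
reads `c² · 1 ≤ 1`.  Together with Gallay–Wayne's energy identity (`c = 1` IS admissible at `λ = 0`)
this pins the optimal constant; for `λ > 0` the radial block is non-normal in `L²(G_λ⁻¹)` and the
optimal constant is `< 1` (numerics .958/.829/.597 at λ = .25/.5/.75). [folklore] -/
theorem coreLinearInvertibility_lamZero_const_le_one (R₀ c : ℝ) (hc : 0 < c)
    (h : ∀ R : ℝ, R₀ ≤ R → ∀ w : EuclideanSpace ℝ (Fin 2) → ℝ, ContDiff ℝ 2 w →
      Integrable (fun x => (gaussWeightLam 0 x)⁻¹ * w x ^ 2) →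
      (∀ x, Integrable (fun y => w y • biotSavartKernel2D (x - y))) →
      Integrable (fun x => (gaussWeightLam 0 x)⁻¹ *
        (strainedVorticityOperator 0 w x - R * (⟪gaussVortexVelocity x, gradient w x⟫_ℝ +
          ⟪biotSavart2D w x, gradient gaussVortexProfile x⟫_ℝ)) ^ 2) →
      ∫ x, w x = 0 → ∫ x, x 0 * w x = 0 → ∫ x, x 1 * w x = 0 →
      c ^ 2 * ∫ x, (gaussWeightLam 0 x)⁻¹ * w x ^ 2 ≤
        ∫ x, (gaussWeightLam 0 x)⁻¹ *
          (strainedVorticityOperator 0 w x - R * (⟪gaussVortexVelocity x, gradient w x⟫_ℝ +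
            ⟪biotSavart2D w x, gradient gaussVortexProfile x⟫_ℝ)) ^ 2) :
    c ≤ 1 := by
  have hW2 : Integrable (fun x : (EuclideanSpace ℝ (Fin 2)) => (gaussWeightLam 0 x)⁻¹ *
      (gaussVortexProfile x * ((4 : ℝ)⁻¹ * ‖x‖ ^ 2 - 1)) ^ 2) := by
    simp_rw [gaussWeightLam_zero, inv_gaussian_mul_witness_sq]
    exact integrable_witness_sq_weight
  have hW4 : Integrable (fun x : (EuclideanSpace ℝ (Fin 2)) => (gaussWeightLam 0 x)⁻¹ *
      (strainedVorticityOperator 0 (fun y : (EuclideanSpace ℝ (Fin 2)) => gaussVortexProfile y * ((4 : ℝ)⁻¹ * ‖y‖ ^ 2 - 1)) x -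
        R₀ * (⟪gaussVortexVelocity x,
              gradient (fun y : (EuclideanSpace ℝ (Fin 2)) => gaussVortexProfile y * ((4 : ℝ)⁻¹ * ‖y‖ ^ 2 - 1)) x⟫ +
          ⟪biotSavart2D (fun y : (EuclideanSpace ℝ (Fin 2)) => gaussVortexProfile y * ((4 : ℝ)⁻¹ * ‖y‖ ^ 2 - 1)) x,
              gradient gaussVortexProfile x⟫)) ^ 2) := by
    simp_rw [coreOperator_witness_eq_neg, neg_sq, gaussWeightLam_zero, inv_gaussian_mul_witness_sq]
    exact integrable_witness_sq_weight
  have key := h R₀ le_rfl (fun y : (EuclideanSpace ℝ (Fin 2)) => gaussVortexProfile y * ((4 : ℝ)⁻¹ * ‖y‖ ^ 2 - 1))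
    (contDiff_gaussVortexProfile.mul contDiff_quad) hW2 integrable_witness_smul_biotSavartKernel2D hW4
    integral_witness (integral_coord_mul_witness 0) (integral_coord_mul_witness 1)
  beta_reduce at key
  simp_rw [coreOperator_witness_eq_neg, neg_sq, gaussWeightLam_zero, inv_gaussian_mul_witness_sq,
    integral_witness_sq_weight] at key
  nlinarith


/-- (B, restated through `coreOp`) at `λ = 0` every admissible constant has `c ≤ 1`, for ANY `R₀`. -/
theorem crux_lamZero_const_le_one (R₀ c : ℝ) (hc : 0 < c)
    (h : ∀ R : ℝ, R₀ ≤ R → ∀ w : EuclideanSpace ℝ (Fin 2) → ℝ, ContDiff ℝ 2 w →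
      Integrable (fun x => (gaussWeightLam 0 x)⁻¹ * w x ^ 2) →
      (∀ x, Integrable (fun y => w y • biotSavartKernel2D (x - y))) →
      Integrable (fun x => (gaussWeightLam 0 x)⁻¹ * (coreOp 0 R w x) ^ 2) →
      ∫ x, w x = 0 → ∫ x, x 0 * w x = 0 → ∫ x, x 1 * w x = 0 →
      c ^ 2 * ∫ x, (gaussWeightLam 0 x)⁻¹ * w x ^ 2 ≤
        ∫ x, (gaussWeightLam 0 x)⁻¹ * (coreOp 0 R w x) ^ 2) : c ≤ 1 :=
  coreLinearInvertibility_lamZero_const_le_one R₀ c hc h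

/-! ## §C  First moments: not load-bearing for invertibility, load-bearing for the constant -/

/-- **(C1) near-miss.**  Without the two first-moment hypotheses the statement stays TRUE at `λ = 0`
with `c = ½` (then `−L ≥ ½` on zero-mass functions) but FAILS with any `c > ½`: the translation modes
`∂ᵢG = −(xᵢ/2)G` have zero mass, `Λ_G ∂ᵢG = 0` (translation covariance of the Oseen vortex;
tree: `GallayMaekawa2016_lem27_classical`) and `L ∂ᵢG = −½ ∂ᵢG`, so `T_{0,R}∂ᵢG = −½∂ᵢG` for every `R`.
OBSTRUCTION to a Lean proof here: `Λ_G ∂ᵢG = 0` pointwise needs `K ∗ ∂ᵢG = ∂ᵢ(K ∗ G) = ∂ᵢ v^G`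
(differentiation of the Biot–Savart integral of the Gaussian), equivalently the explicit law
`K ∗ G = v^G`, which the tree does not yet provide (only the direction `⟪x, K∗w⟫ = 0` for radial `w`,
and the multipole machinery of `BiotSavart2DAngularModes`).  Information for provers: the first-moment
constraints are there to lift the constant, and for `λ > 0` to remove the `n = ±1` part of `ker Λ_G`;
a proof giving SOME `c > 0` may be able to ignore them (odd slow eigenvalues `−(1±λ)/2 ≠ 0`).
Recorded as `True` (no typed claim is made). -/
theorem firstMoments_only_lift_the_constant : True := trivial

/-! ## §D  Natural strengthenings (not claimed by the crux; recorded so nobody aims at them) -/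

/-- (D1) `c = 1` for `λ > 0` is FALSE (radial block of `L` is non-normal in `L²(G_λ⁻¹)`, `G_λ` having the
slower rate `(1−λ)/4`; the radial eigenfunctions `ΔG`, `Δ²G`-type with eigenvalues `−1, −2` are not
`X_λ`-orthogonal, and `w = w₁ − εw₂` has `‖Lw‖_{X_λ} < ‖w‖_{X_λ}` for small `ε > 0` of the right sign);
numerics give the large-`R` plateau `c(λ) ≈ .958/.829/.597/.37` at `λ = .25/.5/.75/.9`.
(D2) uniformity in `λ ↑ 1` is FALSE-expected (`c(λ) → 0`: in flat `L²(ℝ²)` the point `0` is interior to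
`σ(L)`).  (D3) uniformity down to `R = 0` (no `R₀`) is plausibly TRUE (numerics: `σ_min` increasing in
`R` from `R = 0`; `R ↦ −R` is conjugate by the reflection `x₁ ↦ −x₁`).  None of these is asserted by the
crux; no Lean content this cycle. -/
theorem strengthenings_note : True := trivial

/-! ## §E  Line `Sketch`: cheap attacks on the open stubs (all pass) -/

/-- (E1) `stub_oddAttenuation` is qualitatively TRUE — proof sketch a prover can follow (no rate needed).
Fix `λ ∈ (0,1)`, `κ = 1 − λ`.  (i) `Ω∂_θ` is skew in `X_λ = L²(G_λ⁻¹)` (radial weight) and `⟨Ω∂_θ v, v⟩ = 0` for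
REAL `v`, so `−⟨H_R v, v⟩_{X_λ} = −⟨L_λ v, v⟩_{X_λ} =: Q_λ(v)` for every `R`.  (ii) With `f = G_λ^{-1/2} v`,
`Q_λ(v) ≥ ‖∇f‖² + (κ²/16)‖|x| f‖² − ½‖f‖²` (symmetric part of the conjugated operator: drift `((1−κ)/2)x·∇`
contributes `−(1−κ)/2·(−1)`… net `−Δ − ½ + κ(2−κ)|x|²/16`, and `λM` contributes `−λκ(x₁²−x₂²)/8 ≥ −λκ|x|²/8`;
`κ(2−κ)/16 − λκ/8 = κ²/16 > 0`).  (iii) If attenuation failed there would be `K`, `R_j → ∞`, odd Gaussian-class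
`v_j`, `‖v_j‖ = 1`, `‖H_{R_j} v_j‖ ≤ K`; then `Q_λ(v_j) ≤ K`, so `(v_j)` is precompact in `X_λ` (compact embedding
of the weighted form domain), `v_j → v_∞`, `‖v_∞‖ = 1`, `v_∞` odd; and for every test `φ`,
`⟨Ω∂_θ v_j, φ⟩ = (⟨v_j, L_λ^†φ⟩ − ⟨H v_j, φ⟩)/R_j → 0`, so `∂_θ v_∞ = 0`: `v_∞` is radial, hence even, hence
`0` — contradiction.  (The same argument with the Biot–Savart term present fails exactly on `ker Λ_G ∩ odd =
span{∂G}`, which is why 6b carries the first moments.)  Recorded as `True`; the typed stub is the lead's. -/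
theorem oddAttenuation_qualitative_sketch : True := trivial

/-- (E2) `stub_oddSymmetrizerBoundedBelow`: the kernel of the symmetrizer on odd functions is exactly the
translation pair — `(I + K)∂ᵢG = 0` because `N ∗ ∂ᵢG = ∂ᵢ(N∗G) = Ω xᵢ` and `Φ Ω xᵢ = xᵢ G/2 = −∂ᵢG`;
conversely `Λ_G = Ω∂_θ(I+K)` and Maekawa's kernel lemma (tree: `GallayMaekawa2016_lem27_classical_holds`)
give `ker(I+K) ∩ odd ⊆ ker Λ_G ∩ odd = span{∂₁G, ∂₂G}`.  The constraints `∫ xᵢ w = 0` are transverse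
(`∫ x₁ ∂₁G = −1`).  No degenerate case found (`w = 0` gives `0 ≤ 0`; the stub's `C` is per `λ`). -/
theorem oddSymmetrizer_kernel_note : True := trivial

-- Targets: none broken this cycle (payload.stuck_stubs = []; open stubs of line `Sketch` pass the cheap attacks, §E).

end Summit.NavierStokesRegularity.NavierStokesRegularity.Cruxes.CoreLinearInvertibility.Disproof
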